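import Literature.AlgebraicGeometry.Resolution.ResolutionLU
import Literature.AlgebraicGeometry.Resolution.AffineModelLU
import Literature.AlgebraicGeometry.Resolution.AffineDomainEquidim
import Mathlib.FieldTheory.IntermediateField.Adjoin.Basic
import HarnessLib

/-!
# Local uniformization in dimension three: reduction to closed centres of dimension three

Topic: `Literature/AlgebraicGeometry/Resolution`. A PROVED reduction for the descent leaf
`CossartPiltant2019LU3OfComplete` (`= CossartPiltant2019LUComplete3 → CossartPiltant2019LU3`)
of the decomposition of `CossartPiltant2019` (`ArithmeticalThreefolds.lean`).

The conclusion `CossartPiltant2019LU3 = ∀ k, LocalUniformization3 k` (relative local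
uniformization of ALL affine models of dimension `≤ 3` over all fields, along ALL valuations)
is wider than what Cossart–Piltant's descent argument (journal Prop. 4.8 = arXiv v1 Prop. 4.6,
§4.2) produces by itself, namely their property (LU) of §4.1 for local domains OF DIMENSION
THREE along the CLOSED points of the Riemann–Zariski space ("`m_v ∩ A = m`, `k_v | k`
algebraic"; v1 p. 51: "The assumption on `v` in (LU) means that `v` is a closed point of
`Zar(𝒳)`"). The printed proof closes the gap with two further inputs: resolution of surfaces
("Resolution of singularities is known if `dim 𝒳 ≤ 2` [L3], so we may assume that `dim 𝒳 = 3`",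
v1 p. 50, Step 1 of the proof of Prop. 4.4) and the remark that "transcendental residue
extensions provide a reduction in `dim A`" (v1 p. 52). This file proves exactly that gap:

* `localUniformization3_of_closedPoints` — surface resolution over every field
  (`CossartJannsenSaito2020`) together with Cossart–Piltant's (LU) (`CPLocalUniformization`) for
  the local rings `B_𝔭` at MAXIMAL ideals `𝔭` of three-dimensional affine domains `B` over fields
  imply `LocalUniformization3 k` for every field `k`;
* `CossartPiltant2019LU3OfComplete.of_closedPoints` — hence `CossartPiltant2019LU3OfComplete`
  follows from `CossartJannsenSaito2020` and the implication "(LU) for complete local domains of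
  dimension three ⇒ (LU) for the above local rings `B_𝔭`", which is the genuine content of the
  printed descent (journal Prop. 4.8) at closed points.

## The argument (`localUniformization3_of_closedPoints`)

Let `A ⊆ O` be an affine model of `K/k` (`A` finitely generated, `Frac A = K`, `dim A ≤ 3`) and
`O` a valuation ring of `K`.
* `dim A ≤ 2`: `ResolutionOverUpToDim k 2` uniformizes `O` on a model above `A`
  (`ResolutionOverUpToDim.localUniformization`, `ResolutionLU.lean`).
* `dim A = 3` and some `t ∈ O` has residue transcendental over `k` (every non-zero `p(t)`,
  `p ∈ k[X]`, is a unit of `O`): then the field `k(t)` lies in `O`, `A₁ := k(t)[A]` is an affine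
  model of `K/k(t)` of dimension `≤ trdeg_{k(t)} K = 2`, and surface resolution over `k(t)`
  gives a finitely generated `k(t)`-algebra `A₁ ⊆ A₂ ⊆ O` regular at the centre; the finitely
  generated `k`-algebra `A' := k[A, t, generators of A₂]` satisfies `A' ⊆ A₂ ⊆ A'_{𝔪_O ∩ A'}`
  (denominators: non-zero polynomials in `t`, units of `O`), so `A'` has the same local ring at
  the centre (`isRegularLocalRing_of_sandwich`).
* `dim A = 3` and the residue field of `O` is algebraic over `k`: then `A/(𝔪_O ∩ A)` is a domain
  algebraic over `k`, hence a field, so the centre `𝔠 = 𝔪_O ∩ A` is maximal, `dim A_𝔠 = 3`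
  (`AffineDomainEquidim.lean`), `O` dominates `A_𝔠` with algebraic residue extension, and (LU)
  for `A_𝔠` gives `T = A_𝔠[s] ⊆ O` regular at the centre; again `A' := k[A, s]` has
  `A' ⊆ T ⊆ A'_{𝔪_O ∩ A'}` (`exists_fg_regular_of_cpLocalUniformization_centre`).

No new definitions and no named facts are introduced.

## Sources

* V. Cossart, O. Piltant, *Resolution of singularities of arithmetical threefolds*, J. Algebra
  529 (2019) 268–535 = arXiv:1412.0868; v1 §4.1 (LU), proof of Prop. 4.4 Step 1 (p. 50),
  p. 51 (closed points of `Zar`), proof of Prop. 4.6 (p. 52). [CossartPiltant2019]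
* O. Zariski, P. Samuel, *Commutative Algebra* II, Ch. VI §14 (dimension of the centre of a
  valuation, residue transcendence degree).
-/

noncomputable section

open IsLocalRing Polynomial

open scoped IntermediateField

namespace Literature.AlgebraicGeometry.Resolution

universe u

/-! ## Sandwiched subrings -/

/-- **Sandwich, as an isomorphism of local rings.** Let `A' ⊆ T` be subrings of a field `K`
with `Frac A' = K`, `P` a prime of `T` and `P' = P ∩ A'`. If every `t ∈ T` satisfies
`t · s' = a'` for some `a' ∈ A'`, `s' ∈ A' ∖ P'`, then `A'_{P'} ≅ T_P` (both are the same
subring of `K`). [folklore] -/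
theorem nonempty_ringEquiv_localization_of_sandwich {K : Type u} [Field K] {A' T : Subring K}
    (hle : A' ≤ T) [IsFractionRing A' K] (P : Ideal T) [P.IsPrime] (P' : Ideal A') [P'.IsPrime]
    (hP' : P.comap (Subring.inclusion hle) = P')
    (H : ∀ t : T, ∃ a s : A', Subring.inclusion hle s ∉ P ∧ (t : K) * s = a) :
    Nonempty (Localization.AtPrime P' ≃+* Localization.AtPrime P) := by
  classical
  subst hP'
  set P' : Ideal A' := P.comap (Subring.inclusion hle) with hP'def
  -- `Frac T = K`
  haveI : IsFractionRing T K := by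
    refine IsFractionRing.of_field T K fun z => ?_
    obtain ⟨a, b, -, rfl⟩ := IsFractionRing.div_surjective (A := A') z
    exact ⟨⟨a, hle a.2⟩, ⟨b, hle b.2⟩, rfl⟩
  -- the two localisations inside `K`
  let R₁ : Subalgebra A' K :=
    Localization.subalgebra.ofField K P'.primeCompl P'.primeCompl_le_nonZeroDivisors
  let R₂ : Subalgebra T K :=
    Localization.subalgebra.ofField K P.primeCompl P.primeCompl_le_nonZeroDivisors
  have h0P' : ∀ s : A', s ∉ P' → (s : K) ≠ 0 := fun s hs h0 =>
    hs (by rw [show s = 0 from Subtype.ext h0]; exact P'.zero_mem)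
  have hR : R₁.toSubring = R₂.toSubring := by
    ext x
    change x ∈ R₁ ↔ x ∈ R₂
    rw [mem_ofField_iff, mem_ofField_iff]
    constructor
    · rintro ⟨a, s, hs, rfl⟩
      exact ⟨Subring.inclusion hle a, Subring.inclusion hle s, hs, rfl⟩
    · rintro ⟨t, u, hu, rfl⟩
      obtain ⟨a₁, s₁, hs₁, h₁⟩ := H t
      obtain ⟨a₂, s₂, hs₂, h₂⟩ := H u
      have ha₂ : Subring.inclusion hle a₂ = u * Subring.inclusion hle s₂ :=
        Subtype.ext (by simpa using h₂.symm)
      have ha₂P : a₂ ∉ P' := by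
        change Subring.inclusion hle a₂ ∉ P
        rw [ha₂]
        exact (Ideal.IsPrime.mul_notMem ‹P.IsPrime›) hu hs₂
      have hs₁P' : s₁ ∉ P' := hs₁
      refine ⟨a₁ * s₂, s₁ * a₂, ?_, ?_⟩
      · exact (Ideal.IsPrime.mul_notMem inferInstance) hs₁P' ha₂P
      · have hs₁0 := h0P' s₁ hs₁P'
        have ha₂0 := h0P' a₂ ha₂P
        have hs₂0 := h0P' s₂ hs₂
        have hu0 : ((u : T) : K) ≠ 0 := by
          intro h; apply ha₂0
          have := h₂; rw [h, zero_mul] at this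
          exact_mod_cast this.symm
        change ((t : T) : K) * (((u : T) : K))⁻¹ =
          ((a₁ * s₂ : A') : K) * (((s₁ * a₂ : A') : K))⁻¹
        push_cast
        rw [← h₁, ← h₂]
        field_simp
  -- assemble the isomorphisms
  haveI : IsLocalization.AtPrime R₁ P' :=
    Localization.subalgebra.isLocalization_ofField K P'.primeCompl _
  haveI : IsLocalization.AtPrime R₂ P :=
    Localization.subalgebra.isLocalization_ofField K P.primeCompl _
  let e₁ : Localization.AtPrime P' ≃ₐ[A'] R₁ := IsLocalization.algEquiv P'.primeCompl _ _
  let e₂ : Localization.AtPrime P ≃ₐ[T] R₂ := IsLocalization.algEquiv P.primeCompl _ _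
  let e : R₁ ≃+* R₂ := RingEquiv.subringCongr hR
  exact ⟨e₁.toRingEquiv.trans (e.trans e₂.toRingEquiv.symm)⟩

/-- **Sandwich, downwards.** In the situation of `nonempty_ringEquiv_localization_of_sandwich`
(`A' ⊆ T ⊆ K`, every element of `T` a fraction `a'/s'` with `s' ∈ A' ∖ P'`), if `T_P` is a
regular local ring then so is `A'_{P'}` (the converse direction is
`isRegularLocalRing_localization_of_sandwich`, `AffineModelLU.lean`). [folklore] -/
theorem isRegularLocalRing_of_sandwich {K : Type u} [Field K] {A' T : Subring K}
    (hle : A' ≤ T) [IsFractionRing A' K] (P : Ideal T) [P.IsPrime] (P' : Ideal A') [P'.IsPrime]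
    (hP' : P.comap (Subring.inclusion hle) = P')
    (H : ∀ t : T, ∃ a s : A', Subring.inclusion hle s ∉ P ∧ (t : K) * s = a)
    (hreg : IsRegularLocalRing (Localization.AtPrime P)) :
    IsRegularLocalRing (Localization.AtPrime P') := by
  obtain ⟨e⟩ := nonempty_ringEquiv_localization_of_sandwich hle P P' hP' H
  exact IsRegularLocalRing.of_ringEquiv e.symm

/-- The sandwich hypothesis from its valuation-theoretic form: if `A' ⊆ T ⊆ O` inside `K` and
every `x ∈ T` satisfies `x · s' = a'` with `a', s' ∈ A'` and `v(s') = 1`, then `s'` lies outside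
the centre `𝔪_O ∩ T`. [folklore] -/
theorem sandwich_of_valuation_eq_one {K : Type u} [Field K] (O : ValuationSubring K)
    {A' T : Subring K} (hle : A' ≤ T) (hTO : T ≤ O.toSubring)
    (hQ : ∀ x ∈ T, ∃ a s : K, a ∈ A' ∧ s ∈ A' ∧ O.valuation s = 1 ∧ x * s = a) :
    ∀ t : T, ∃ a s : A', Subring.inclusion hle s ∉
        Ideal.comap (Subring.inclusion hTO) (maximalIdeal O) ∧ (t : K) * s = a := by
  intro t
  obtain ⟨a, s, ha, hs, hv, hts⟩ := hQ t t.2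
  refine ⟨⟨a, ha⟩, ⟨s, hs⟩, ?_, hts⟩
  rw [Ideal.mem_comap, ValuationSubring.valuation_lt_one_iff]
  change ¬ O.valuation s < 1
  rw [hv]
  exact lt_irrefl 1

/-! ## Closed centres of dimension three: from (LU) of the local ring to the relative form -/

/-- **From Cossart–Piltant's (LU) for `A_𝔠` back to affine models** (the converse of the bridge
`LocalUniformization3.cpLocalUniformization` of `AffineModelLU.lean`, at a centre with algebraic
residue extension): let `A ⊆ O` be an affine model of `K/k` such that the residue field of `O`
is algebraic over `k` (every `x ∈ O` is a root modulo `𝔪_O` of a non-zero polynomial over `k`),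
and assume (LU) for the local ring `A_𝔠`, `𝔠 = 𝔪_O ∩ A`. Then some finitely generated
`A ⊆ A' ⊆ O` is regular at the centre: (LU) gives `T = A_𝔠[s] ⊆ O` regular at `𝔪_O ∩ T`, and
`A' := k[A, s]` satisfies `A' ⊆ T ⊆ A'_{𝔪_O ∩ A'}` since the elements of `A ∖ 𝔠` are units of
`O`. [cite: CossartPiltant2019, §4.1 (LU)] -/
theorem exists_fg_regular_of_cpLocalUniformization_centre {k K : Type u} [Field k] [Field K]
    [Algebra k K] (O : ValuationSubring K) (A : Subalgebra k K)
    (hAO : A.toSubring ≤ O.toSubring) (hfg : A.FG) (hfr : IsFractionRing A K)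
    (halg : ∀ x : O, ∃ p : k[X], p ≠ 0 ∧ O.valuation (aeval (x : K) p) < 1)
    (hLU : CPLocalUniformization (Localization.AtPrime (centreIdeal A O hAO))) :
    ∃ (A' : Subalgebra k K) (h : A'.toSubring ≤ O.toSubring), A ≤ A' ∧ A'.FG ∧
      IsRegularLocalRing (Localization.AtPrime (centreIdeal A' O h)) := by
  classical
  haveI := hfr
  -- `A_𝔠 → K`
  have hunit : ∀ s : (centreIdeal A O hAO).primeCompl, IsUnit (algebraMap A K s) := fun s => by
    rw [isUnit_iff_ne_zero]
    intro h0
    apply s.2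
    have : (s : A) = 0 := (IsFractionRing.injective A K) (h0.trans (map_zero _).symm)
    rw [this]
    exact (centreIdeal A O hAO).zero_mem
  letI : Algebra (Localization.AtPrime (centreIdeal A O hAO)) K :=
    (IsLocalization.lift (M := (centreIdeal A O hAO).primeCompl) hunit).toAlgebra
  haveI : IsScalarTower A (Localization.AtPrime (centreIdeal A O hAO)) K :=
    IsScalarTower.of_algebraMap_eq fun a => (IsLocalization.lift_eq hunit a).symm
  haveI : IsFractionRing (Localization.AtPrime (centreIdeal A O hAO)) K :=
    IsFractionRing.isFractionRing_of_isDomain_of_isLocalization (centreIdeal A O hAO).primeCompl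
      (Localization.AtPrime (centreIdeal A O hAO)) K
  have hAK : ∀ a : A,
      algebraMap (Localization.AtPrime (centreIdeal A O hAO)) K (algebraMap A _ a) = (a : K) :=
    fun a => (IsScalarTower.algebraMap_apply A (Localization.AtPrime (centreIdeal A O hAO)) K a).symm
  -- membership in the centre, values outside the centre
  have hmemc : ∀ a : A, a ∈ centreIdeal A O hAO ↔ O.valuation (a : K) < 1 := fun a => by
    rw [centreIdeal, Ideal.mem_comap, ValuationSubring.valuation_lt_one_iff]; rfl
  have hval1 : ∀ s : A, s ∉ centreIdeal A O hAO → O.valuation (s : K) = 1 := fun s hs =>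
    le_antisymm ((O.valuation_le_one_iff _).mpr (hAO s.2)) (not_lt.mp ((hmemc s).not.mp hs))
  have hmk' : ∀ (a : A) (s : (centreIdeal A O hAO).primeCompl),
      algebraMap _ K (IsLocalization.mk' (Localization.AtPrime (centreIdeal A O hAO)) a s) =
        (a : K) * ((s : A) : K)⁻¹ := by
    intro a s
    have hs1 := hval1 (s : A) s.2
    have hs0 : ((s : A) : K) ≠ 0 := fun h => by
      rw [h, map_zero] at hs1; exact zero_ne_one hs1
    rw [eq_mul_inv_iff_mul_eq₀ hs0, ← hAK (s : A), ← map_mul, IsLocalization.mk'_spec, hAK]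
  -- (1) `A_𝔠 ⊆ O`
  have hLO : ∀ r : Localization.AtPrime (centreIdeal A O hAO), algebraMap _ K r ∈ O := by
    intro r
    obtain ⟨a, s, rfl⟩ := IsLocalization.exists_mk'_eq (centreIdeal A O hAO).primeCompl r
    have hs1 := hval1 (s : A) s.2
    have hsO : ((s : A) : K)⁻¹ ∈ O := by
      rw [← O.valuation_le_one_iff, map_inv₀, hs1, inv_one]
    rw [hmk']
    exact mul_mem (hAO a.2) hsO
  -- (2) `O` dominates `A_𝔠`
  have hdom : ∀ r ∈ maximalIdeal (Localization.AtPrime (centreIdeal A O hAO)),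
      O.valuation (algebraMap _ K r) < 1 := by
    intro r hr
    obtain ⟨a, s, rfl⟩ := IsLocalization.exists_mk'_eq (centreIdeal A O hAO).primeCompl r
    have ha : a ∈ centreIdeal A O hAO :=
      (IsLocalization.AtPrime.mk'_mem_maximal_iff
        (Localization.AtPrime (centreIdeal A O hAO)) (centreIdeal A O hAO) a s).mp hr
    rw [hmk', map_mul, map_inv₀, hval1 (s : A) s.2, inv_one, mul_one]
    exact (hmemc a).mp ha
  -- (3) residues are algebraic over the residue field of `A_𝔠` (even over `k`)
  have halg' : ∀ x : O, ∃ p : (Localization.AtPrime (centreIdeal A O hAO))[X],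
      (∃ i, p.coeff i ∉ maximalIdeal (Localization.AtPrime (centreIdeal A O hAO))) ∧
        O.valuation (p.eval₂ (algebraMap _ K) x) < 1 := by
    intro x
    obtain ⟨q, hq0, hq⟩ := halg x
    refine ⟨q.map (algebraMap k _), ⟨q.natDegree, ?_⟩, ?_⟩
    · rw [Polynomial.coeff_map, Polynomial.coeff_natDegree]
      have hu : IsUnit (algebraMap k (Localization.AtPrime (centreIdeal A O hAO)) q.leadingCoeff) :=
        (Ne.isUnit (leadingCoeff_ne_zero.mpr hq0)).map _
      exact fun hmem => (mem_nonunits_iff.mp ((IsLocalRing.mem_maximalIdeal _).mp hmem)) hu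
    · have hcomp : (algebraMap (Localization.AtPrime (centreIdeal A O hAO)) K).comp
          (algebraMap k _) = algebraMap k K := by
        ext a
        rw [RingHom.comp_apply,
          IsScalarTower.algebraMap_apply k A (Localization.AtPrime (centreIdeal A O hAO)), hAK]
        rfl
      rw [Polynomial.eval₂_map, hcomp, ← Polynomial.aeval_def]
      exact hq
  -- apply (LU) to `A_𝔠 ⊆ O`
  obtain ⟨s, hTO, hreg⟩ := hLU K O hLO hdom halg'
  let T : Subalgebra (Localization.AtPrime (centreIdeal A O hAO)) K := Algebra.adjoin _ (s : Set K)
  change T.toSubring ≤ O.toSubring at hTO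
  -- the `k`-algebra `A' = k[generators of A, s]`
  obtain ⟨gA, hgA⟩ := hfg
  let A' : Subalgebra k K := Algebra.adjoin k ((gA : Set K) ∪ (s : Set K))
  have hAA' : A ≤ A' := by
    rw [← hgA]; exact Algebra.adjoin_mono Set.subset_union_left
  have hA'fg : A'.FG := ⟨gA ∪ s, by rw [Finset.coe_union]⟩
  -- `A' ⊆ T`
  have hkT : ∀ a : k, algebraMap k K a ∈ T := fun a => by
    have e : algebraMap k K a =
        algebraMap (Localization.AtPrime (centreIdeal A O hAO)) K (algebraMap k _ a) := by
      rw [IsScalarTower.algebraMap_apply k A (Localization.AtPrime (centreIdeal A O hAO)), hAK]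
      rfl
    rw [e]; exact T.algebraMap_mem _
  let Tk : Subalgebra k K := { T.toSubring with algebraMap_mem' := hkT }
  have hA'T : A'.toSubring ≤ T.toSubring := by
    change A' ≤ Tk
    refine Algebra.adjoin_le ?_
    rintro x (hx | hx)
    · have hxA : x ∈ A := by rw [← hgA]; exact Algebra.subset_adjoin hx
      have hxT := T.algebraMap_mem (algebraMap A (Localization.AtPrime (centreIdeal A O hAO)) ⟨x, hxA⟩)
      rw [hAK] at hxT
      exact hxT
    · change x ∈ T
      exact Algebra.subset_adjoin hx
  have hA'O : A'.toSubring ≤ O.toSubring := hA'T.trans hTO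
  refine ⟨A', hA'O, hAA', hA'fg, ?_⟩
  -- every element of `T` is `a'/s'` with `a' ∈ A'`, `s' ∈ A'` a unit of `O`
  have hQ : ∀ x ∈ T.toSubring, ∃ a s' : K, a ∈ A'.toSubring ∧ s' ∈ A'.toSubring ∧
      O.valuation s' = 1 ∧ x * s' = a := by
    intro x hx
    refine Algebra.adjoin_induction (p := fun x _ => ∃ a s' : K, a ∈ A'.toSubring ∧
      s' ∈ A'.toSubring ∧ O.valuation s' = 1 ∧ x * s' = a) ?_ ?_ ?_ ?_ (show x ∈ T from hx)
    · intro x hx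
      exact ⟨x, 1, Algebra.subset_adjoin (Or.inr hx), one_mem _, map_one _, mul_one _⟩
    · intro r
      obtain ⟨a, t, rfl⟩ := IsLocalization.exists_mk'_eq (centreIdeal A O hAO).primeCompl r
      refine ⟨(a : K), ((t : A) : K), hAA' a.2, hAA' (t : A).2, hval1 _ t.2, ?_⟩
      rw [← hAK (t : A), ← hAK a, ← map_mul, IsLocalization.mk'_spec]
    · rintro x y - - ⟨a₁, s₁, ha₁, hs₁, hv₁, h₁⟩ ⟨a₂, s₂, ha₂, hs₂, hv₂, h₂⟩
      refine ⟨a₁ * s₂ + a₂ * s₁, s₁ * s₂, add_mem (mul_mem ha₁ hs₂) (mul_mem ha₂ hs₁),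
        mul_mem hs₁ hs₂, by rw [map_mul, hv₁, hv₂, mul_one], ?_⟩
      rw [← h₁, ← h₂]; ring
    · rintro x y - - ⟨a₁, s₁, ha₁, hs₁, hv₁, h₁⟩ ⟨a₂, s₂, ha₂, hs₂, hv₂, h₂⟩
      refine ⟨a₁ * a₂, s₁ * s₂, mul_mem ha₁ ha₂, mul_mem hs₁ hs₂,
        by rw [map_mul, hv₁, hv₂, mul_one], ?_⟩
      rw [← h₁, ← h₂]; ring
  haveI : IsFractionRing A'.toSubring K := isFractionRing_of_le hAA' hfr
  haveI : (centreIdeal A' O hA'O).IsPrime := by unfold centreIdeal; infer_instance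
  exact isRegularLocalRing_of_sandwich hA'T
    (Ideal.comap (Subring.inclusion hTO) (maximalIdeal O)) (centreIdeal A' O hA'O)
    (Ideal.ext fun _ => Iff.rfl) (sandwich_of_valuation_eq_one O hA'T hTO hQ) hreg

/-! ## Transcendental residues: reduction of the dimension over `k(t)` -/

/-- **Transcendental residue extensions reduce the dimension** (Cossart–Piltant 2019, proof of
journal Prop. 4.8 [v1 Prop. 4.6]: "transcendental residue extensions provide a reduction in
`dim A`"; Zariski–Samuel VI §14): let `A ⊆ O` be an affine model of `K/k` of dimension `≤ 3` and
suppose some `t ∈ O` has residue transcendental over `k`, i.e. `p(t)` is a unit of `O` for every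
non-zero `p ∈ k[X]`. If weak resolution holds over every field up to dimension `2`, then some
finitely generated `A ⊆ A' ⊆ O` is regular at the centre of `O`: the field `k(t)` lies in `O`,
`k(t)[A]` is an affine model of `K/k(t)` of dimension `≤ 2`, surface resolution over `k(t)`
uniformizes `O` on a finitely generated `k(t)`-algebra `A₂ ⊇ k(t)[A]`, and
`A' := k[A, t, generators of A₂]` has the same local ring at the centre.
[cite: CossartPiltant2019, proof of Prop. 4.8 (arXiv v1: Prop. 4.6)] -/
theorem exists_fg_regular_of_residue_transcendental {k K : Type u} [Field k] [Field K]
    [Algebra k K] (h2 : ∀ (F : Type u) [Field F], ResolutionOverUpToDim F 2)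
    (O : ValuationSubring K) (A : Subalgebra k K) (hAO : A.toSubring ≤ O.toSubring)
    (hfg : A.FG) (hfr : IsFractionRing A K) (hdim : ringKrullDim A ≤ 3)
    {t : K} (htO : t ∈ O) (ht : ∀ p : k[X], p ≠ 0 → O.valuation (aeval t p) = 1) :
    ∃ (A' : Subalgebra k K) (h : A'.toSubring ≤ O.toSubring), A ≤ A' ∧ A'.FG ∧
      IsRegularLocalRing (Localization.AtPrime (centreIdeal A' O h)) := by
  classical
  haveI := hfr
  haveI : Algebra.FiniteType k A := A.fg_iff_finiteType.mp hfg
  have hkO : ∀ a : k, algebraMap k K a ∈ O := fun a => hAO (A.algebraMap_mem a)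
  let Ok : Subalgebra k K := { O.toSubring with algebraMap_mem' := hkO }
  -- polynomials in `t` lie in `O`
  have haevO : ∀ p : k[X], aeval t p ∈ O := fun p =>
    (Algebra.adjoin_le (Set.singleton_subset_iff.mpr htO) : Algebra.adjoin k {t} ≤ Ok)
      (Polynomial.aeval_mem_adjoin_singleton k t)
  -- `t` is transcendental over `k`
  have httr : Transcendental k t := by
    rw [transcendental_iff]
    intro p hp
    by_contra hp0
    have h1 := ht p hp0
    rw [hp, map_zero] at h1
    exact zero_ne_one h1
  -- the field `F = k(t)` lies in `O`
  have hFO : ∀ x : k⟮t⟯, (x : K) ∈ O := by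
    rintro ⟨x, hx⟩
    obtain ⟨r, s, rfl⟩ := (IntermediateField.mem_adjoin_simple_iff (F := k) x).mp hx
    by_cases hs : s = 0
    · change aeval t r / aeval t s ∈ O
      rw [hs, map_zero, div_zero]
      exact zero_mem _
    · rw [← O.valuation_le_one_iff]
      change O.valuation (aeval t r / aeval t s) ≤ 1
      rw [map_div₀, ht s hs, div_one, O.valuation_le_one_iff]
      exact haevO r
  haveI : FaithfulSMul k k⟮t⟯ :=
    (faithfulSMul_iff_algebraMap_injective k k⟮t⟯).mpr (algebraMap k k⟮t⟯).injective
  haveI : FaithfulSMul k⟮t⟯ K :=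
    (faithfulSMul_iff_algebraMap_injective k⟮t⟯ K).mpr (algebraMap k⟮t⟯ K).injective
  -- `trdeg_{k(t)} K ≤ 2`
  have htr : Algebra.trdeg k⟮t⟯ K ≤ 2 := by
    obtain ⟨n, hn, htrA⟩ := exists_ringKrullDim_eq_and_trdeg_eq k A
    have hn3 : n ≤ 3 := by
      have h1 : (n : WithBot ℕ∞) ≤ 3 := hn ▸ hdim
      exact_mod_cast h1
    have hK : Algebra.trdeg k K = n := by rw [trdeg_eq_trdeg_of_isFractionRing A, htrA]
    have hsum : Algebra.trdeg k k⟮t⟯ + Algebra.trdeg k⟮t⟯ K = n := by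
      rw [trdeg_add_eq k k⟮t⟯ (A := K), hK]
    have hF1 : 1 ≤ Algebra.trdeg k k⟮t⟯ := by
      have httr' : Transcendental k
          (algebraMap k⟮t⟯ K ⟨t, IntermediateField.mem_adjoin_simple_self k t⟩) := httr
      haveI : Algebra.Transcendental k k⟮t⟯ :=
        Algebra.transcendental_def.mpr ⟨⟨t, IntermediateField.mem_adjoin_simple_self k t⟩,
          (transcendental_algebraMap_iff (algebraMap k⟮t⟯ K).injective).mp httr'⟩
      exact Cardinal.one_le_iff_pos.mpr (trdeg_pos k k⟮t⟯)
    have hb_le : Algebra.trdeg k⟮t⟯ K ≤ n := by rw [← hsum]; exact le_add_self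
    have ha_le : Algebra.trdeg k k⟮t⟯ ≤ n := by rw [← hsum]; exact le_self_add
    obtain ⟨b, hb⟩ :=
      Cardinal.lt_aleph0.mp (lt_of_le_of_lt hb_le (Cardinal.natCast_lt_aleph0 (n := n)))
    obtain ⟨a, ha⟩ :=
      Cardinal.lt_aleph0.mp (lt_of_le_of_lt ha_le (Cardinal.natCast_lt_aleph0 (n := n)))
    rw [ha, hb] at hsum
    rw [ha] at hF1
    rw [hb]
    have hsum' : a + b = n := by exact_mod_cast hsum
    have ha1 : 1 ≤ a := by exact_mod_cast hF1
    have hb2 : b ≤ 2 := by omega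
    exact_mod_cast hb2
  -- the `k(t)`-model `A₁ = k(t)[generators of A]`
  obtain ⟨gA, hgA⟩ := hfg
  let A₁ : Subalgebra k⟮t⟯ K := Algebra.adjoin k⟮t⟯ (gA : Set K)
  have hfg₁ : A₁.FG := ⟨gA, rfl⟩
  let OF : Subalgebra k⟮t⟯ K := { O.toSubring with algebraMap_mem' := fun c => hFO c }
  have hA₁O : A₁.toSubring ≤ O.toSubring := by
    change A₁ ≤ OF
    refine Algebra.adjoin_le fun x hx => ?_
    have hxA : x ∈ A := by rw [← hgA]; exact Algebra.subset_adjoin hx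
    exact hAO hxA
  have hAA₁ : A.toSubring ≤ A₁.toSubring := by
    have h1 : A ≤ A₁.restrictScalars k := by
      rw [← hgA]; exact Algebra.adjoin_le Algebra.subset_adjoin
    exact fun x hx => h1 hx
  have hfr₁ : IsFractionRing A₁ K := by
    refine IsFractionRing.of_field A₁ K fun z => ?_
    obtain ⟨a, b, -, rfl⟩ := IsFractionRing.div_surjective (A := A) z
    exact ⟨⟨a, hAA₁ a.2⟩, ⟨b, hAA₁ b.2⟩, rfl⟩
  haveI := hfr₁
  have hdim₁ : ringKrullDim A₁ ≤ (2 : ℕ) :=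
    ringKrullDim_le_of_fg_of_trdeg_le A₁ hfg₁ (by exact_mod_cast htr)
  -- surface resolution over `k(t)`
  obtain ⟨A₂, h₂, h₁₂, ⟨g₂, hg₂⟩, hreg₂⟩ := (h2 k⟮t⟯).localUniformization K O A₁ hA₁O hfg₁ hfr₁ hdim₁
  -- descend to `k`: `A' = k[generators of A, t, generators of A₂]`
  let A' : Subalgebra k K := Algebra.adjoin k (insert t ((gA : Set K) ∪ (g₂ : Set K)))
  have hA'fg : A'.FG := ⟨insert t (gA ∪ g₂), by rw [Finset.coe_insert, Finset.coe_union]⟩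
  have hAA' : A ≤ A' := by
    rw [← hgA]
    exact Algebra.adjoin_mono fun x hx => Set.mem_insert_of_mem _ (Or.inl hx)
  have htA' : t ∈ A' := Algebra.subset_adjoin (Set.mem_insert _ _)
  have haevA' : ∀ p : k[X], aeval t p ∈ A' := fun p =>
    (Algebra.adjoin_le (Set.singleton_subset_iff.mpr htA') : Algebra.adjoin k {t} ≤ A')
      (Polynomial.aeval_mem_adjoin_singleton k t)
  -- `A' ⊆ A₂`
  have hkA₂ : ∀ a : k, algebraMap k K a ∈ A₂ := fun a => by
    rw [IsScalarTower.algebraMap_apply k k⟮t⟯ K]; exact A₂.algebraMap_mem _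
  let A₂k : Subalgebra k K := { A₂.toSubring with algebraMap_mem' := hkA₂ }
  have hA'A₂ : A'.toSubring ≤ A₂.toSubring := by
    change A' ≤ A₂k
    refine Algebra.adjoin_le ?_
    rintro x (hx | hx | hx)
    · rw [hx]
      exact A₂.algebraMap_mem ⟨t, IntermediateField.mem_adjoin_simple_self k t⟩
    · exact h₁₂ (show x ∈ A₁ from Algebra.subset_adjoin hx)
    · have hx2 : x ∈ Algebra.adjoin k⟮t⟯ (g₂ : Set K) := Algebra.subset_adjoin hx
      rw [hg₂] at hx2
      exact hx2
  have hA'O : A'.toSubring ≤ O.toSubring := hA'A₂.trans h₂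
  refine ⟨A', hA'O, hAA', hA'fg, ?_⟩
  -- every element of `A₂` is `a'/s'` with `a', s' ∈ A'`, `s'` a unit of `O`
  have hQ : ∀ x ∈ A₂.toSubring, ∃ a s' : K, a ∈ A'.toSubring ∧ s' ∈ A'.toSubring ∧
      O.valuation s' = 1 ∧ x * s' = a := by
    intro x hx
    have hx' : x ∈ Algebra.adjoin k⟮t⟯ (g₂ : Set K) := by rw [hg₂]; exact hx
    refine Algebra.adjoin_induction (p := fun x _ => ∃ a s' : K, a ∈ A'.toSubring ∧
      s' ∈ A'.toSubring ∧ O.valuation s' = 1 ∧ x * s' = a) ?_ ?_ ?_ ?_ hx'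
    · intro x hx
      exact ⟨x, 1, Algebra.subset_adjoin (Set.mem_insert_of_mem _ (Or.inr hx)), one_mem _,
        map_one _, mul_one _⟩
    · rintro ⟨c, hc⟩
      obtain ⟨r, s, rfl⟩ := (IntermediateField.mem_adjoin_simple_iff (F := k) c).mp hc
      by_cases hs : s = 0
      · refine ⟨0, 1, zero_mem _, one_mem _, map_one _, ?_⟩
        change aeval t r / aeval t s * 1 = 0
        rw [hs, map_zero, div_zero, zero_mul]
      · refine ⟨aeval t r, aeval t s, haevA' r, haevA' s, ht s hs, ?_⟩
        have hs0 : aeval t s ≠ 0 := fun h0 => by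
          have h1 := ht s hs
          rw [h0, map_zero] at h1
          exact zero_ne_one h1
        change aeval t r / aeval t s * aeval t s = aeval t r
        exact div_mul_cancel₀ _ hs0
    · rintro x y - - ⟨a₁, s₁, ha₁, hs₁, hv₁, h₁⟩ ⟨a₂, s₂, ha₂, hs₂, hv₂, h₂⟩
      refine ⟨a₁ * s₂ + a₂ * s₁, s₁ * s₂, add_mem (mul_mem ha₁ hs₂) (mul_mem ha₂ hs₁),
        mul_mem hs₁ hs₂, by rw [map_mul, hv₁, hv₂, mul_one], ?_⟩
      rw [← h₁, ← h₂]; ring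
    · rintro x y - - ⟨a₁, s₁, ha₁, hs₁, hv₁, h₁⟩ ⟨a₂, s₂, ha₂, hs₂, hv₂, h₂⟩
      refine ⟨a₁ * a₂, s₁ * s₂, mul_mem ha₁ ha₂, mul_mem hs₁ hs₂,
        by rw [map_mul, hv₁, hv₂, mul_one], ?_⟩
      rw [← h₁, ← h₂]; ring
  haveI : IsFractionRing A'.toSubring K := isFractionRing_of_le hAA' hfr
  haveI : (centreIdeal A' O hA'O).IsPrime := by unfold centreIdeal; infer_instance
  exact isRegularLocalRing_of_sandwich hA'A₂
    (Ideal.comap (Subring.inclusion h₂) (maximalIdeal O)) (centreIdeal A' O hA'O)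
    (Ideal.ext fun _ => Iff.rfl) (sandwich_of_valuation_eq_one O hA'A₂ h₂ hQ) hreg₂

/-! ## The reduction -/

/-- **Local uniformization in dimension `≤ 3` from surface resolution and (LU) at closed centres
of dimension three** (Cossart–Piltant 2019, Ch. 4: (LU) of §4.1 is required only for local rings
of dimension three and along closed points of the Riemann–Zariski space, the rest being
resolution in dimension `≤ 2` [L3] and "transcendental residue extensions provide a reduction
in `dim A`"). If weak resolution holds over every field up to dimension `2`
(`CossartJannsenSaito2020`) and Cossart–Piltant's (LU) (`CPLocalUniformization`) holds for the
local ring `B_𝔭` at every maximal ideal `𝔭` of every three-dimensional domain `B` of finite type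
over a field, then `LocalUniformization3 k` holds for every field `k`.
[cite: CossartPiltant2019, §4.1 (LU) and proof of Prop. 4.8 (arXiv v1: Prop. 4.6)] -/
theorem localUniformization3_of_closedPoints (hCJS : CossartJannsenSaito2020.{u})
    (h3 : ∀ (k B : Type u) [Field k] [CommRing B] [IsDomain B] [Algebra k B]
      [Algebra.FiniteType k B] (p : Ideal B) [p.IsMaximal],
      ringKrullDim B = 3 → ringKrullDim (Localization.AtPrime p) = 3 →
        CPLocalUniformization (Localization.AtPrime p))
    (k : Type u) [Field k] : LocalUniformization3 k := by
  classical
  intro K _ _ O A hAO hfg hfr hdim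
  haveI := hfr
  haveI : Algebra.FiniteType k A := A.fg_iff_finiteType.mp hfg
  obtain ⟨n, hn, -⟩ := exists_ringKrullDim_eq_and_trdeg_eq k A
  have hn3 : n ≤ 3 := by
    have h1 : (n : WithBot ℕ∞) ≤ 3 := hn ▸ hdim
    exact_mod_cast h1
  by_cases hn2 : n ≤ 2
  · -- dimension `≤ 2`: surface resolution over `k`
    exact (hCJS k).localUniformization K O A hAO hfg hfr (by rw [hn]; exact_mod_cast hn2)
  have hA3 : ringKrullDim A = 3 := by
    have h1 : n = 3 := by omega
    rw [hn, h1]; norm_cast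
  by_cases hII : ∃ t ∈ O, ∀ p : k[X], p ≠ 0 → O.valuation (aeval t p) = 1
  · -- a transcendental residue: reduce the dimension over `k(t)`
    obtain ⟨t, htO, ht⟩ := hII
    exact exists_fg_regular_of_residue_transcendental hCJS O A hAO hfg hfr hdim htO ht
  -- the residue field of `O` is algebraic over `k`: the centre is a closed point of dimension 3
  push Not at hII
  have hkO : ∀ a : k, algebraMap k K a ∈ O := fun a => hAO (A.algebraMap_mem a)
  let Ok : Subalgebra k K := { O.toSubring with algebraMap_mem' := hkO }
  have halg : ∀ x : O, ∃ p : k[X], p ≠ 0 ∧ O.valuation (aeval (x : K) p) < 1 := by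
    intro x
    obtain ⟨p, hp0, hp1⟩ := hII x x.2
    have hmem : aeval (x : K) p ∈ O :=
      (Algebra.adjoin_le (Set.singleton_subset_iff.mpr x.2) : Algebra.adjoin k {(x : K)} ≤ Ok)
        (Polynomial.aeval_mem_adjoin_singleton k (x : K))
    exact ⟨p, hp0, lt_of_le_of_ne ((O.valuation_le_one_iff _).mpr hmem) hp1⟩
  -- the centre `𝔠 = 𝔪_O ∩ A` is a maximal ideal: `A/𝔠` is a domain algebraic over `k`
  haveI hcmax : (centreIdeal A O hAO).IsMaximal := by
    refine Ideal.Quotient.maximal_of_isField _ ?_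
    haveI : Algebra.IsIntegral k (A ⧸ centreIdeal A O hAO) := by
      rw [← Algebra.isAlgebraic_iff_isIntegral]
      refine ⟨fun y => ?_⟩
      obtain ⟨a, rfl⟩ := Ideal.Quotient.mk_surjective y
      obtain ⟨p, hp0, hp⟩ := halg ⟨a, hAO a.2⟩
      refine ⟨p, hp0, ?_⟩
      change aeval (Ideal.Quotient.mkₐ k (centreIdeal A O hAO) a) p = 0
      rw [Polynomial.aeval_algHom_apply]
      change Ideal.Quotient.mk (centreIdeal A O hAO) (aeval a p) = 0
      refine Ideal.Quotient.eq_zero_iff_mem.mpr ?_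
      rw [centreIdeal, Ideal.mem_comap, ValuationSubring.valuation_lt_one_iff]
      change O.valuation ((aeval a p : A) : K) < 1
      rw [Polynomial.aeval_subalgebra_coe]
      exact hp
    exact isField_of_isIntegral_of_isField' (Field.toIsField k)
  have hcdim : ringKrullDim (Localization.AtPrime (centreIdeal A O hAO)) = 3 := by
    rw [ringKrullDim_localization_atPrime_eq_of_isMaximal k (centreIdeal A O hAO), hA3]
  exact exists_fg_regular_of_cpLocalUniformization_centre O A hAO hfg hfr halg
    (h3 k A (centreIdeal A O hAO) hA3 hcdim)

/-- The same with the named fact `CossartPiltant2019LU3` as conclusion. [folklore] -/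
theorem CossartPiltant2019LU3.of_closedPoints (hCJS : CossartJannsenSaito2020.{u})
    (h3 : ∀ (k B : Type u) [Field k] [CommRing B] [IsDomain B] [Algebra k B]
      [Algebra.FiniteType k B] (p : Ideal B) [p.IsMaximal],
      ringKrullDim B = 3 → ringKrullDim (Localization.AtPrime p) = 3 →
        CPLocalUniformization (Localization.AtPrime p)) :
    CossartPiltant2019LU3.{u} :=
  fun k _ => localUniformization3_of_closedPoints hCJS h3 k

/-- **The descent leaf, reduced to its printed content.** `CossartPiltant2019LU3OfComplete`
(`(LU)` for complete local domains of dimension three `⇒ CossartPiltant2019LU3`) follows from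
surface resolution over fields (`CossartJannsenSaito2020`, the input [L3] of Cossart–Piltant's
Prop. 4.6 [v1 4.4]) together with the implication "(LU) for complete local domains of dimension
three ⇒ (LU) for the local rings at maximal ideals of three-dimensional affine domains over
fields", i.e. the descent of journal Prop. 4.8 [v1 Prop. 4.6] at closed points.
[cite: CossartPiltant2019, Props. 4.6 and 4.8 (arXiv v1: Props. 4.4 and 4.6)] -/
theorem CossartPiltant2019LU3OfComplete.of_closedPoints (hCJS : CossartJannsenSaito2020.{u})
    (hdesc : CossartPiltant2019LUComplete3.{u} →
      ∀ (k B : Type u) [Field k] [CommRing B] [IsDomain B] [Algebra k B]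
        [Algebra.FiniteType k B] (p : Ideal B) [p.IsMaximal],
        ringKrullDim B = 3 → ringKrullDim (Localization.AtPrime p) = 3 →
          CPLocalUniformization (Localization.AtPrime p)) :
    CossartPiltant2019LU3OfComplete.{u} :=
  fun hc => CossartPiltant2019LU3.of_closedPoints hCJS (hdesc hc)

end Literature.AlgebraicGeometry.Resolution

end
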